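import Summits.MatrixMultiplication.MatrixMultiplication.Theorems.SoloInformedValPairPacking
import Summits.MatrixMultiplication.MatrixMultiplication.Theorems.SoloInformedValHubPairFamily

/-!
# SoloInformedValTwoRowHubPair — two satellites of a hub carry at most `|G|/2` triangles

Solo-informed programme (MatrixMultiplication, side question on the value of trapezoid-free triples), gen 81;
dossier `paper/val-superlinear.md` §15.8 (n).

Setting (as in `SoloInformedValInducedMatching`): an abelian group `G`, potentials `x : I → G`, `y : J → G`,
`z : K → G`, pair graphs `H_IJ, H_JK, H_KI`, the hypothesis `NoAccidental` (no accidental solutions), triangles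
`IsTriangle`, the set of all triangles `triangleSet` (its size is the value `T`).  The `JK`-LABEL of a triangle
`(i, j, k)` is `y j - z k`; `linkLabels i` is the set of labels of the triangles through the `I`-vertex `i`
(it has exactly `t_i` elements by link injectivity, `NoAccidental.injOn_link`).

## Results

* `two_mul_card_le_of_isolated` (THE SQUARE LEMMA, pure group combinatorics).  Let `B₁, B₂ ⊆ G` be finite,
  `B = B₁ ∪ B₂`, and `a₁, a₂ ∈ G` with `(B₁ ± a₁) ∩ B = ∅` and `(B₂ ± a₂) ∩ B = ∅`.  Then `2|B| ≤ |G|`.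
  PROOF: for every `g`, at most two of the four corners `g, g + a₁, g + a₂, g + a₁ + a₂` of the "square at `g`"
  lie in `B` (`square_count_le_two`): the corners form a 4-cycle whose sides are `±a₁`- and `±a₂`-steps, each
  corner has one `a₁`-neighbour and one `a₂`-neighbour on the cycle, and a corner in `B₁` (resp. `B₂`) forbids its
  `a₁`-neighbour (resp. `a₂`-neighbour); among any three corners one has both of its cycle-neighbours among the
  other two, so three corners in `B` are impossible.  Summing over `g` (each of the four corner maps is a
  bijection of `G`): `4|B| ≤ 2|G|`.  No hypothesis on `a₁, a₂` is needed (degenerate squares are covered by the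
  same case analysis).
* `NoAccidental.two_mul_card_linkLabels_union_le` (HUB ISOLATION ⟹ SQUARE LEMMA APPLIES).  Let `h` be a HUB:
  `(i, j) ∈ H_IJ ⟹ (h, j) ∈ H_IJ` and `(k, i) ∈ H_KI ⟹ (k, h) ∈ H_KI` for all `i`; let `i₁, i₂ ≠ h`
  (SATELLITES, not necessarily distinct).  Nested packing (`NoAccidental.shifted_label_ne`, both directions)
  says that `b ± (x iₛ - x h)` is never a `JK`-label for `b ∈ linkLabels iₛ`; hence
  `2 |linkLabels i₁ ∪ linkLabels i₂| ≤ |G|`, and if the links of `i₁`, `i₂` share no `JK`-edge,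
  `2 (t_{i₁} + t_{i₂}) ≤ |G|` (`NoAccidental.two_mul_card_links_le`).
* `NoAccidental.card_triangleSet_le_of_hub_two_satellites` (TWO-ROW HUB CONFIGURATIONS ARE LINEAR).  If
  `I = {h, i₁, i₂}` with `h` a hub, the links of `i₁, i₂` edge-disjoint, and every triangle through `h` sharing
  its `JK`-edge with a triangle through `i₁` or `i₂`, then `T ≤ |G|`.  In particular every HUB PAIR (two complete
  blocks `X₁ × Y₁ × Z₁`, `X₂ × Y₂ × Z₂`, `X₁ ∩ X₂ = {hub}`, `Y₁ ∩ Y₂ = ∅ = Z₁ ∩ Z₂`, accidental-free union) with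
  TWO-ROW blocks `|X₁| = |X₂| = 2` has `v₁ + v₂ ≤ |G|`: conjecture (U8*) of the dossier holds for them, and the
  density-`→ 1` family of `SoloInformedValHubPairFamily` (`T = 2qr + 2` in `ℤ/(2qr + 2q + r + 3)`) shows the
  bound is asymptotically sharp; `fam_hub_hypotheses` checks that that family satisfies the hypotheses.
* SCOPE (`three_shifts_exceed_half`).  The pure isolation argument does not extend to three satellites: in
  `ℤ/6` the sets `B₁ = {4}`, `B₂ = {1}`, `B₃ = {0, 2}` with shifts `1, 2, 3` satisfy `(Bₛ ± aₛ) ∩ B = ∅` and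
  `|B| = 4 > 3`; likewise for blocks with `≥ 3` rows the per-square weighted count exceeds what `T ≤ |G|` needs
  (dossier (15.8)(n)).  Hub pairs with a block of `≥ 3` rows and hubs with `≥ 3` satellites remain open
  (no superlinear example of order `≤ 31`, gen 79 census).
Elementary; no `sorry`.
-/

namespace Summit.MatrixMultiplication.MatrixMultiplication.Theorems.SoloVal

open Finset

section Square

variable {G : Type*} [AddCommGroup G] [DecidableEq G]

/-- CORNER LEMMA.  Under the isolation hypotheses, an element of `B = B₁ ∪ B₂` cannot have both an
`a₁`-neighbour (`u + a₁` or `u - a₁`) and an `a₂`-neighbour in `B`: if `u ∈ B₁` its `a₁`-neighbours are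
outside `B`, if `u ∈ B₂` its `a₂`-neighbours are. -/
theorem corner_false {B₁ B₂ : Finset G} {a₁ a₂ : G}
    (h₁ : ∀ b ∈ B₁, b + a₁ ∉ B₁ ∪ B₂ ∧ b - a₁ ∉ B₁ ∪ B₂)
    (h₂ : ∀ b ∈ B₂, b + a₂ ∉ B₁ ∪ B₂ ∧ b - a₂ ∉ B₁ ∪ B₂) {u : G} (hu : u ∈ B₁ ∪ B₂)
    (hu₁ : u + a₁ ∈ B₁ ∪ B₂ ∨ u - a₁ ∈ B₁ ∪ B₂) (hu₂ : u + a₂ ∈ B₁ ∪ B₂ ∨ u - a₂ ∈ B₁ ∪ B₂) : False := by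
  rcases Finset.mem_union.mp hu with h | h
  · rcases hu₁ with h' | h'
    · exact (h₁ u h).1 h'
    · exact (h₁ u h).2 h'
  · rcases hu₂ with h' | h'
    · exact (h₂ u h).1 h'
    · exact (h₂ u h).2 h'

/-- SQUARE COUNT.  For every `g`, at most two of the four corners `g, g + a₁, g + a₂, g + a₁ + a₂` lie in
`B = B₁ ∪ B₂`. -/
theorem square_count_le_two {B₁ B₂ : Finset G} {a₁ a₂ : G}
    (h₁ : ∀ b ∈ B₁, b + a₁ ∉ B₁ ∪ B₂ ∧ b - a₁ ∉ B₁ ∪ B₂)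
    (h₂ : ∀ b ∈ B₂, b + a₂ ∉ B₁ ∪ B₂ ∧ b - a₂ ∉ B₁ ∪ B₂) (g : G) :
    ((if g ∈ B₁ ∪ B₂ then 1 else 0) + (if g + a₁ ∈ B₁ ∪ B₂ then 1 else 0)
      + (if g + a₂ ∈ B₁ ∪ B₂ then 1 else 0) + (if g + a₁ + a₂ ∈ B₁ ∪ B₂ then 1 else 0) : ℕ) ≤ 2 := by
  -- the four "three corners" patterns, each refuted at the corner whose two cycle-neighbours are present
  have L0 : g ∈ B₁ ∪ B₂ → g + a₁ ∈ B₁ ∪ B₂ → g + a₂ ∈ B₁ ∪ B₂ → False := fun h0 h1 h2 =>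
    corner_false h₁ h₂ h0 (Or.inl h1) (Or.inl h2)
  have L1 : g + a₁ ∈ B₁ ∪ B₂ → g ∈ B₁ ∪ B₂ → g + a₁ + a₂ ∈ B₁ ∪ B₂ → False := fun h1 h0 h3 =>
    corner_false h₁ h₂ h1 (Or.inr (by rw [add_sub_cancel_right]; exact h0)) (Or.inl h3)
  have L2 : g + a₂ ∈ B₁ ∪ B₂ → g + a₁ + a₂ ∈ B₁ ∪ B₂ → g ∈ B₁ ∪ B₂ → False := fun h2 h3 h0 =>
    corner_false h₁ h₂ h2 (Or.inl (by rw [add_right_comm]; exact h3))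
      (Or.inr (by rw [add_sub_cancel_right]; exact h0))
  have L3 : g + a₁ + a₂ ∈ B₁ ∪ B₂ → g + a₂ ∈ B₁ ∪ B₂ → g + a₁ ∈ B₁ ∪ B₂ → False := fun h3 h2 h1 =>
    corner_false h₁ h₂ h3 (Or.inr (by rw [show g + a₁ + a₂ - a₁ = g + a₂ from by abel]; exact h2))
      (Or.inr (by rw [add_sub_cancel_right]; exact h1))
  by_cases h0 : g ∈ B₁ ∪ B₂ <;> by_cases h1 : g + a₁ ∈ B₁ ∪ B₂ <;> by_cases h2 : g + a₂ ∈ B₁ ∪ B₂ <;>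
    by_cases h3 : g + a₁ + a₂ ∈ B₁ ∪ B₂ <;> simp only [h0, h1, h2, h3, if_true, if_false] <;>
    first
      | omega
      | exact (L0 ‹_› ‹_› ‹_›).elim
      | exact (L1 ‹_› ‹_› ‹_›).elim
      | exact (L2 ‹_› ‹_› ‹_›).elim
      | exact (L3 ‹_› ‹_› ‹_›).elim

/-- Translation invariance: the number of `g` with `g + c ∈ B` is `|B|`. -/
theorem sum_boole_add_mem [Fintype G] (B : Finset G) (c : G) :
    ∑ g : G, (if g + c ∈ B then 1 else 0 : ℕ) = B.card := by
  rw [Finset.sum_boole, Nat.cast_id]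
  refine Finset.card_bij (fun g _ => g + c) (fun g hg => (Finset.mem_filter.mp hg).2)
    (fun g₁ _ g₂ _ h => add_right_cancel h) (fun b hb => ⟨b - c, ?_, sub_add_cancel b c⟩)
  simp [hb]

/-- THE SQUARE LEMMA.  If `(B₁ ± a₁) ∩ (B₁ ∪ B₂) = ∅` and `(B₂ ± a₂) ∩ (B₁ ∪ B₂) = ∅`, then
`2 |B₁ ∪ B₂| ≤ |G|`. -/
theorem two_mul_card_le_of_isolated [Fintype G] {B₁ B₂ : Finset G} {a₁ a₂ : G}
    (h₁ : ∀ b ∈ B₁, b + a₁ ∉ B₁ ∪ B₂ ∧ b - a₁ ∉ B₁ ∪ B₂)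
    (h₂ : ∀ b ∈ B₂, b + a₂ ∉ B₁ ∪ B₂ ∧ b - a₂ ∉ B₁ ∪ B₂) :
    2 * (B₁ ∪ B₂).card ≤ Fintype.card G := by
  have e0 := sum_boole_add_mem (B₁ ∪ B₂) 0
  have e1 := sum_boole_add_mem (B₁ ∪ B₂) a₁
  have e2 := sum_boole_add_mem (B₁ ∪ B₂) a₂
  have e3 := sum_boole_add_mem (B₁ ∪ B₂) (a₁ + a₂)
  simp only [add_zero] at e0
  simp only [← add_assoc] at e3
  have hle : ∑ g : G, ((if g ∈ B₁ ∪ B₂ then 1 else 0) + (if g + a₁ ∈ B₁ ∪ B₂ then 1 else 0)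
      + (if g + a₂ ∈ B₁ ∪ B₂ then 1 else 0) + (if g + a₁ + a₂ ∈ B₁ ∪ B₂ then 1 else 0) : ℕ)
      ≤ ∑ _g : G, (2 : ℕ) :=
    Finset.sum_le_sum (fun g _ => square_count_le_two h₁ h₂ g)
  rw [Finset.sum_add_distrib, Finset.sum_add_distrib, Finset.sum_add_distrib, e0, e1, e2, e3] at hle
  simp only [Finset.sum_const, Finset.card_univ, smul_eq_mul] at hle
  omega

/-- SCOPE: the isolation argument is special to two shifts.  In `ℤ/6`, `B₁ = {4}`, `B₂ = {1}`, `B₃ = {0, 2}`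
with shifts `a = 1, 2, 3` satisfy `(Bₛ ± aₛ) ∩ B = ∅` for `B = B₁ ∪ B₂ ∪ B₃`, yet `2|B| = 8 > 6`. -/
theorem three_shifts_exceed_half :
    let B₁ : Finset (ZMod 6) := {4}
    let B₂ : Finset (ZMod 6) := {1}
    let B₃ : Finset (ZMod 6) := {0, 2}
    let B := B₁ ∪ B₂ ∪ B₃
    (∀ b ∈ B₁, b + 1 ∉ B ∧ b - 1 ∉ B) ∧ (∀ b ∈ B₂, b + 2 ∉ B ∧ b - 2 ∉ B) ∧
      (∀ b ∈ B₃, b + 3 ∉ B ∧ b - 3 ∉ B) ∧ Fintype.card (ZMod 6) < 2 * B.card := by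
  decide

end Square

section Hub

variable {G : Type*} [AddCommGroup G] [DecidableEq G]
variable {I J K : Type*}
variable {x : I → G} {y : J → G} {z : K → G}
variable {HIJ : Finset (I × J)} {HJK : Finset (J × K)} {HKI : Finset (K × I)}

/-- HUB ISOLATION (nested packing, both directions).  If `h` is adjacent to the `J`- and `K`-ends of a triangle
`(i, j, k)` with `i ≠ h`, then neither `y j - z k + (x i - x h)` nor `y j - z k - (x i - x h)` is a `JK`-label. -/
theorem NoAccidental.shift_not_label (hN : NoAccidental x y z HIJ HJK HKI) {h i : I} (hne : i ≠ h)
    {j : J} {k : K} (ht : IsTriangle HIJ HJK HKI (i, j, k)) (hhj : (h, j) ∈ HIJ) (hkh : (k, h) ∈ HKI) :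
    y j - z k + (x i - x h) ∉ HJK.image (fun e => y e.1 - z e.2) ∧
      y j - z k - (x i - x h) ∉ HJK.image (fun e => y e.1 - z e.2) := by
  obtain ⟨hij, -, hki⟩ := ht
  constructor
  · intro hmem
    obtain ⟨⟨j', k'⟩, hjk', heq⟩ := Finset.mem_image.mp hmem
    exact hN.shifted_label_ne (Ne.symm hne) hhj hki hjk' heq.symm
  · intro hmem
    obtain ⟨⟨j', k'⟩, hjk', heq⟩ := Finset.mem_image.mp hmem
    refine hN.shifted_label_ne hne hij hkh hjk' ?_
    simp only at heq
    rw [heq]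
    abel

variable [DecidableEq I] [DecidableEq J] [DecidableEq K]

/-- The set of triangles through the `I`-vertex `i` (the LINK of `i`, as triangles); its size is `t_i`. -/
def link (HIJ : Finset (I × J)) (HJK : Finset (J × K)) (HKI : Finset (K × I)) (i : I) :
    Finset (I × J × K) :=
  (triangleSet HIJ HJK HKI).filter (fun τ => τ.1 = i)

/-- The `JK`-labels `y j - z k` of the triangles `(i, j, k)` through `i`. -/
def linkLabels (y : J → G) (z : K → G) (HIJ : Finset (I × J)) (HJK : Finset (J × K))
    (HKI : Finset (K × I)) (i : I) : Finset G :=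
  (link HIJ HJK HKI i).image (fun τ => y τ.2.1 - z τ.2.2)

/-- Membership in `link`. -/
theorem mem_link {i : I} {τ : I × J × K} :
    τ ∈ link HIJ HJK HKI i ↔ IsTriangle HIJ HJK HKI τ ∧ τ.1 = i := by
  rw [link, Finset.mem_filter, mem_triangleSet]

/-- Membership in `linkLabels`: `b` is the label of a triangle `(i, j, k)`. -/
theorem mem_linkLabels {i : I} {b : G} :
    b ∈ linkLabels y z HIJ HJK HKI i ↔ ∃ j k, IsTriangle HIJ HJK HKI (i, j, k) ∧ y j - z k = b := by
  constructor
  · intro hb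
    obtain ⟨⟨i', j, k⟩, hτ, rfl⟩ := Finset.mem_image.mp hb
    obtain ⟨ht, hi⟩ := mem_link.mp hτ
    simp only at hi
    subst hi
    exact ⟨j, k, ht, rfl⟩
  · rintro ⟨j, k, ht, rfl⟩
    exact Finset.mem_image.mpr ⟨(i, j, k), mem_link.mpr ⟨ht, rfl⟩, rfl⟩

/-- Labels of triangles are labels of `JK`-edges. -/
theorem linkLabels_subset_image (i : I) :
    linkLabels y z HIJ HJK HKI i ⊆ HJK.image (fun e => y e.1 - z e.2) := by
  intro b hb
  obtain ⟨j, k, ht, rfl⟩ := mem_linkLabels.mp hb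
  exact Finset.mem_image.mpr ⟨(j, k), ht.2.1, rfl⟩

/-- LINK INJECTIVITY, counted: `t_i = |linkLabels i|`. -/
theorem NoAccidental.card_link_eq (hN : NoAccidental x y z HIJ HJK HKI) (i : I) :
    (link HIJ HJK HKI i).card = (linkLabels y z HIJ HJK HKI i).card := by
  refine (Finset.card_image_of_injOn ?_).symm
  rintro ⟨i₁, j, k⟩ hτ ⟨i₂, j', k'⟩ hτ' heq
  obtain ⟨ht, hi⟩ := mem_link.mp (Finset.mem_coe.mp hτ)
  obtain ⟨ht', hi'⟩ := mem_link.mp (Finset.mem_coe.mp hτ')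
  simp only at hi hi' heq
  rw [hi] at ht
  rw [hi'] at ht'
  have h := hN.injOn_link i
    (show ((j, k) : J × K) ∈ {e : J × K | IsTriangle HIJ HJK HKI (i, e.1, e.2)} from ht)
    (show ((j', k') : J × K) ∈ {e : J × K | IsTriangle HIJ HJK HKI (i, e.1, e.2)} from ht') heq
  simp only [Prod.mk.injEq] at h
  rw [hi, hi', h.1, h.2]

/-- TWO SATELLITES OF A HUB.  Let `h` be a hub (`(i, j) ∈ H_IJ ⟹ (h, j) ∈ H_IJ`, `(k, i) ∈ H_KI ⟹ (k, h) ∈ H_KI`)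
and `i₁, i₂ ≠ h`.  Then the label sets of the links of `i₁` and `i₂` together have at most `|G|/2` elements. -/
theorem NoAccidental.two_mul_card_linkLabels_union_le [Fintype G] (hN : NoAccidental x y z HIJ HJK HKI)
    {h i₁ i₂ : I}
    (hne₁ : i₁ ≠ h) (hne₂ : i₂ ≠ h) (hdomJ : ∀ i j, (i, j) ∈ HIJ → (h, j) ∈ HIJ)
    (hdomK : ∀ k i, (k, i) ∈ HKI → (k, h) ∈ HKI) :
    2 * (linkLabels y z HIJ HJK HKI i₁ ∪ linkLabels y z HIJ HJK HKI i₂).card ≤ Fintype.card G := by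
  have hsub : linkLabels y z HIJ HJK HKI i₁ ∪ linkLabels y z HIJ HJK HKI i₂ ⊆
      HJK.image (fun e => y e.1 - z e.2) :=
    Finset.union_subset (linkLabels_subset_image i₁) (linkLabels_subset_image i₂)
  have key : ∀ {i : I}, i ≠ h → ∀ b ∈ linkLabels y z HIJ HJK HKI i,
      b + (x i - x h) ∉ linkLabels y z HIJ HJK HKI i₁ ∪ linkLabels y z HIJ HJK HKI i₂ ∧
      b - (x i - x h) ∉ linkLabels y z HIJ HJK HKI i₁ ∪ linkLabels y z HIJ HJK HKI i₂ := by
    intro i hne b hb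
    obtain ⟨j, k, ht, rfl⟩ := mem_linkLabels.mp hb
    have hh := hN.shift_not_label hne ht (hdomJ i j ht.1) (hdomK k i ht.2.2)
    exact ⟨fun hm => hh.1 (hsub hm), fun hm => hh.2 (hsub hm)⟩
  exact two_mul_card_le_of_isolated (key hne₁) (key hne₂)

/-- TWO SATELLITES OF A HUB, counted in triangles: if moreover the links of `i₁` and `i₂` share no `JK`-edge,
then `2 (t_{i₁} + t_{i₂}) ≤ |G|`. -/
theorem NoAccidental.two_mul_card_links_le [Fintype G] (hN : NoAccidental x y z HIJ HJK HKI) {h i₁ i₂ : I}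
    (hne₁ : i₁ ≠ h) (hne₂ : i₂ ≠ h) (hdomJ : ∀ i j, (i, j) ∈ HIJ → (h, j) ∈ HIJ)
    (hdomK : ∀ k i, (k, i) ∈ HKI → (k, h) ∈ HKI)
    (hdisj : ∀ j k, IsTriangle HIJ HJK HKI (i₁, j, k) → ¬ IsTriangle HIJ HJK HKI (i₂, j, k)) :
    2 * ((link HIJ HJK HKI i₁).card + (link HIJ HJK HKI i₂).card) ≤ Fintype.card G := by
  have hd : Disjoint (linkLabels y z HIJ HJK HKI i₁) (linkLabels y z HIJ HJK HKI i₂) := by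
    rw [Finset.disjoint_left]
    intro b hb₁ hb₂
    obtain ⟨j, k, ht, rfl⟩ := mem_linkLabels.mp hb₁
    obtain ⟨j', k', ht', heq⟩ := mem_linkLabels.mp hb₂
    have he := hN.edgeJK_eq_of_label_eq ht' ht heq
    simp only [Prod.mk.injEq] at he
    rw [he.1, he.2] at ht'
    exact hdisj j k ht ht'
  rw [hN.card_link_eq i₁, hN.card_link_eq i₂, ← Finset.card_union_of_disjoint hd]
  exact hN.two_mul_card_linkLabels_union_le hne₁ hne₂ hdomJ hdomK

/-- TWO-ROW HUB CONFIGURATIONS ARE LINEAR.  If every triangle passes through the hub `h` or one of two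
satellites `i₁, i₂` whose links share no `JK`-edge, and every triangle through `h` shares its `JK`-edge with a
triangle through `i₁` or `i₂`, then `T ≤ |G|`.  (Hub pairs with two-row blocks are the case where the three links are the faces
`{h} × (Y₁ × Z₁ ∪ Y₂ × Z₂)`, `{i₁} × Y₁ × Z₁`, `{i₂} × Y₂ × Z₂`.) -/
theorem NoAccidental.card_triangleSet_le_of_hub_two_satellites [Fintype G]
    (hN : NoAccidental x y z HIJ HJK HKI) {h i₁ i₂ : I} (hne₁ : i₁ ≠ h) (hne₂ : i₂ ≠ h)
    (hI : ∀ τ, IsTriangle HIJ HJK HKI τ → τ.1 = h ∨ τ.1 = i₁ ∨ τ.1 = i₂)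
    (hdomJ : ∀ i j, (i, j) ∈ HIJ → (h, j) ∈ HIJ) (hdomK : ∀ k i, (k, i) ∈ HKI → (k, h) ∈ HKI)
    (hcov : ∀ j k, IsTriangle HIJ HJK HKI (h, j, k) →
      IsTriangle HIJ HJK HKI (i₁, j, k) ∨ IsTriangle HIJ HJK HKI (i₂, j, k))
    (hdisj : ∀ j k, IsTriangle HIJ HJK HKI (i₁, j, k) → ¬ IsTriangle HIJ HJK HKI (i₂, j, k)) :
    (triangleSet HIJ HJK HKI).card ≤ Fintype.card G := by
  -- the triangle set is covered by the three links
  have hcover : triangleSet HIJ HJK HKI ⊆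
      link HIJ HJK HKI h ∪ (link HIJ HJK HKI i₁ ∪ link HIJ HJK HKI i₂) := by
    intro τ hτ
    have ht := mem_triangleSet.mp hτ
    rcases hI τ ht with hi | hi | hi
    · exact Finset.mem_union_left _ (mem_link.mpr ⟨ht, hi⟩)
    · exact Finset.mem_union_right _ (Finset.mem_union_left _ (mem_link.mpr ⟨ht, hi⟩))
    · exact Finset.mem_union_right _ (Finset.mem_union_right _ (mem_link.mpr ⟨ht, hi⟩))
  -- the hub's labels are satellite labels
  have hlab : linkLabels y z HIJ HJK HKI h ⊆
      linkLabels y z HIJ HJK HKI i₁ ∪ linkLabels y z HIJ HJK HKI i₂ := by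
    intro b hb
    obtain ⟨j, k, ht, rfl⟩ := mem_linkLabels.mp hb
    rcases hcov j k ht with ht' | ht'
    · exact Finset.mem_union_left _ (mem_linkLabels.mpr ⟨j, k, ht', rfl⟩)
    · exact Finset.mem_union_right _ (mem_linkLabels.mpr ⟨j, k, ht', rfl⟩)
  have hd : Disjoint (linkLabels y z HIJ HJK HKI i₁) (linkLabels y z HIJ HJK HKI i₂) := by
    rw [Finset.disjoint_left]
    intro b hb₁ hb₂
    obtain ⟨j, k, ht, rfl⟩ := mem_linkLabels.mp hb₁
    obtain ⟨j', k', ht', heq⟩ := mem_linkLabels.mp hb₂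
    have he := hN.edgeJK_eq_of_label_eq ht' ht heq
    simp only [Prod.mk.injEq] at he
    rw [he.1, he.2] at ht'
    exact hdisj j k ht ht'
  have hsq := hN.two_mul_card_linkLabels_union_le hne₁ hne₂ hdomJ hdomK
  calc (triangleSet HIJ HJK HKI).card
      ≤ (link HIJ HJK HKI h ∪ (link HIJ HJK HKI i₁ ∪ link HIJ HJK HKI i₂)).card :=
        Finset.card_le_card hcover
    _ ≤ (link HIJ HJK HKI h).card + ((link HIJ HJK HKI i₁).card + (link HIJ HJK HKI i₂).card) :=
        (Finset.card_union_le _ _).trans (Nat.add_le_add_left (Finset.card_union_le _ _) _)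
    _ = (linkLabels y z HIJ HJK HKI h).card + ((linkLabels y z HIJ HJK HKI i₁).card
          + (linkLabels y z HIJ HJK HKI i₂).card) := by
        rw [hN.card_link_eq, hN.card_link_eq, hN.card_link_eq]
    _ ≤ (linkLabels y z HIJ HJK HKI i₁ ∪ linkLabels y z HIJ HJK HKI i₂).card
          + (linkLabels y z HIJ HJK HKI i₁ ∪ linkLabels y z HIJ HJK HKI i₂).card := by
        rw [← Finset.card_union_of_disjoint hd]
        exact Nat.add_le_add_right (Finset.card_le_card hlab) _
    _ ≤ Fintype.card G := by omega

end Hub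

section FamilyCheck

variable {q r : ℕ}

/-- The density-`→ 1` family of `SoloInformedValHubPairFamily` satisfies the hypotheses of
`NoAccidental.card_triangleSet_le_of_hub_two_satellites` with hub `0` and satellites `1, 2`: the bound `T ≤ |G|`
is attained up to a factor `(2qr + 2)/(2qr + 2q + r + 3) → 1`. -/
theorem fam_hub_hypotheses :
    (∀ i : Fin 3, i = 0 ∨ i = 1 ∨ i = 2) ∧
    (∀ (i : Fin 3) (j : Option (Fin q)), (i, j) ∈ famHIJ q → ((0 : Fin 3), j) ∈ famHIJ q) ∧
    (∀ (k : Option (Fin r)) (i : Fin 3), (k, i) ∈ famHKI r → (k, (0 : Fin 3)) ∈ famHKI r) ∧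
    (∀ (j : Option (Fin q)) (k : Option (Fin r)), IsTriangle (famHIJ q) (famHJK q r) (famHKI r) (0, j, k) →
      IsTriangle (famHIJ q) (famHJK q r) (famHKI r) (1, j, k) ∨
      IsTriangle (famHIJ q) (famHJK q r) (famHKI r) (2, j, k)) ∧
    (∀ (j : Option (Fin q)) (k : Option (Fin r)), IsTriangle (famHIJ q) (famHJK q r) (famHKI r) (1, j, k) →
      ¬ IsTriangle (famHIJ q) (famHJK q r) (famHKI r) (2, j, k)) := by
  refine ⟨by decide, ?_, ?_, ?_, ?_⟩
  · intro i j hij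
    rw [mem_famHIJ] at hij ⊢
    rcases hij with ⟨hj, -⟩ | ⟨hj, -⟩
    · exact Or.inl ⟨hj, by show (0 : Fin 3) ≠ 2; decide⟩
    · exact Or.inr ⟨hj, by show (0 : Fin 3) ≠ 1; decide⟩
  · intro k i hki
    rw [mem_famHKI] at hki ⊢
    rcases hki with ⟨hk, -⟩ | ⟨hk, -⟩
    · exact Or.inl ⟨hk, by show (0 : Fin 3) ≠ 2; decide⟩
    · exact Or.inr ⟨hk, by show (0 : Fin 3) ≠ 1; decide⟩
  · intro j k ht
    simp only [IsTriangle, mem_famHIJ, mem_famHJK, mem_famHKI] at ht ⊢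
    rcases j with _ | j <;> rcases k with _ | k <;> simp_all
  · intro j k ht ht'
    simp only [IsTriangle, mem_famHIJ, mem_famHJK, mem_famHKI] at ht ht'
    rcases j with _ | j <;> rcases k with _ | k <;> simp_all

/-- COROLLARY (sanity link): the general bound applied to the family recovers `2qr + 2 ≤ n` for every modulus
`n` admitted by `famNoAccidental_ap`. -/
theorem fam_card_le (q r : ℕ) (hq : 1 ≤ q) :
    (triangleSet (famHIJ q) (famHJK q r) (famHKI r)).card ≤ 2 * q * r + 2 * q + r + 3 := by
  have hn : 0 < 2 * q * r + 2 * q + r + 3 := by omega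
  haveI : NeZero (2 * q * r + 2 * q + r + 3) := ⟨hn.ne'⟩
  have hN := famNoAccidental_ap q r hq
  obtain ⟨hI, hdomJ, hdomK, hcov, hdisj⟩ := (fam_hub_hypotheses (q := q) (r := r))
  have h := hN.card_triangleSet_le_of_hub_two_satellites (h := 0) (i₁ := 1) (i₂ := 2)
    (by decide) (by decide) (fun τ _ => hI τ.1) hdomJ hdomK hcov hdisj
  simpa [ZMod.card] using h

end FamilyCheck

end Summit.MatrixMultiplication.MatrixMultiplication.Theorems.SoloVal
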